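import Summits.QuantumFields.YangMills.Theorems.LuscherReductionDressedRitzPolyakovLiftTransplantFormsFlat
import Summits.QuantumFields.YangMills.Theorems.LuscherReductionOneSiteLevelsAbsLowerPrep
import Summits.QuantumFields.YangMills.Theorems.LuscherReductionDressedRitzPolyakovLiftShadowKernelMoment
import Summits.QuantumFields.YangMills.Theorems.LuscherReductionRunningReductionOneSiteTailFloor
import HarnessLib

/-!
# Route `LuscherReduction`, item `DressedRitz` (stmt-QuantumFields-20205), line «polyakovlift» r6 — wave 2, task W2-F6 (part 2/3):
# (F6a) the per-trial-state estimate at a GENERAL cut-off radius, energy slot read per level; (F6b) norms; (F6a′) the `linkC B³` currency; (F6d) `linkC B³` vs `λ₀(B)`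
# (helper lemmas `--supports stmt-QuantumFields-20205`; fleet seat prover ym-infvol-p2 g8 for the LEAD ym-lead-20205-polyakovlift g2, `WAVE-2-BRIEFS.md` §W2-F6)

With `G_j = χ_R f_j` as in part 1 and the one-site trial state `Ψ_j(U) = χ_R(gnCoord μ U)·f_j(gnCoord μ U)` at chart scale `μ` (`Bμ³ = 1/4`, `c = μ⁹(2π²)⁻³`):
* `trial_estimate_radius` (F6a): for `1 ≤ R ≤ 1/(8μ)`, `μ ≤ 1/8`, `π ≤ B` and flat data `𝔮(G_j) ≤ E_j∫G_j² + Ae^{−R}`, `1 − Ae^{−R} ≤ ∫G_j²`, `Ae^{−R} ≤ 1/2`: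
  `8e^{6B}Zc² · ∫G_j² · (1 − 2μ(E_j + 2A e^{−R}) − μ²K_j) ≤ ⟨Ψ_j, K_B Ψ_j⟩`, `K_j = absLowerK E_j A (C_f²I₉) 0` (the tree's explicit constant; its
  `12288·A` slot is idle slack here) — `…AbsLowerPrep.trial_estimate` with `1/(8μ) ↦ R` and the exponential tail kept explicit instead of `e^{−1/(8μ)} ≤ 3072μ³`;
* `le_l2_trial` / `l2_trial_le` (F6b): `8c(1 − 12μ²R²)∫(χ_Rf_j)² ≤ ‖Ψ_j‖² ≤ 8c∫(χ_Rf_j)²`; `isPhys_trial`: `Ψ_j` is a physical zero-flux test function;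
* `linkC_trial_estimate_radius` (F6a′, the currency of `F9-ASSEMBLY-PLAN.md` §2): `linkC B³ · (1 − 2μ(E_j + 2Ae^{−R}) − μ²K_j) · ‖Ψ_j‖² ≤ ⟨Ψ_j, K_B Ψ_j⟩`;
* `exists_linkC_pow_three_compare_levelValue_zero` (F6d): `linkC B³ ≤ 2λ₀(B)` and `λ₀(B) ≤ linkC B³` for `B ≥ B₀` (re-export of
  `PolyakovLift.exists_linkCE_le_two_mul_levelValue_zero` / `OST.levelValue_zero_le_linkCE`, `linkCE = linkC³` at `L = 1`).

## WHAT THIS IS NOT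
Fixed-lattice one-site (`L = 1`) semiclassical bookkeeping toward ONE stub (`stub_pscaling`) of ONE conditional crux on the femto rung R2b1;
nothing here is infinite volume, a continuum limit, a mass gap or the Clay problem.  Sorry-free, no named fact, no new definitions.
References: M. Lüscher, NPB 219 (1983) 233 [cite: Luscher1983, §2–§3]; S. Agmon, Lectures on exponential decay (1982) [cite: Agmon1982, (1.16″), Cor. 4.5];
Reed–Simon IV [cite: ReedSimonIV1978, Thm. XIII.1–2, XIII.64].
-/

set_option autoImplicit false

noncomputable section

open MeasureTheory Filter Topology Real
open scoped Matrix ENNReal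
open Literature.MathematicalPhysics.QuantumFieldTheory
open Literature.MathematicalPhysics.QuantumLattice
open Literature.Analysis.OperatorTheory.YMMatrixModel

namespace Summit.QuantumFields.YangMills.Theorems.FemtoTransferGap.TransplantForms

open Summit.QuantumFields.YangMills.Theorems.FemtoTransferGap

/-! ### §1. (F6a) The per-trial-state estimate at a general cut-off radius -/

section TrialRadius

variable {k : ℕ} {f : Fin (k + 1) → ZM → ℝ}

/-- **(F6a) The per-trial-state estimate at a general cut-off radius, energy slot read per level.**  Eigenfunction data `f` (smooth,
colour-invariant, decay `|f_j| ≤ C_f e^{−‖x‖}`), ONE level `j` with the flat quasimode inequalities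
`𝔮(χ_R f_j) ≤ E_j ∫(χ_R f_j)² + A e^{−R}` and `1 − A e^{−R} ≤ ∫(χ_R f_j)²` (`E_j = physLevel (j+1)`; §1 supplies them with ONE `A` for all `R ≥ 1`
and all `j`), a radius `1 ≤ R ≤ 1/(8μ)` with `A e^{−R} ≤ 1/2`, chart scale `μ` with `Bμ³ = 1/4`, `μ ≤ 1/8`, and `π ≤ B`.  Then
`8 e^{6B} Z c² · ∫(χ_R f_j)² · (1 − 2μ(E_j + 2A e^{−R}) − μ²K) ≤ ⟨Ψ_j, K_B Ψ_j⟩`, `Ψ_j(U) = χ_R(gnCoord μ U) f_j(gnCoord μ U)`,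
`K = absLowerK E_j A (C_f² ∫e^{−‖y‖}) 0` (the tree's explicit constant; its `12288·A` slot is idle slack here). [cite: Luscher1983, §2–§3] -/
theorem trial_estimate_radius (hsmooth : ∀ j, ∀ n : ℕ∞, ContDiff ℝ n (f j)) (hinv : ∀ j, IsGaugeInv (f j))
    {Cf : ℝ} (hCf : ∀ j x, |f j x| ≤ Cf * Real.exp (-‖x‖))
    {A : ℝ} (hA0 : 0 ≤ A) {R : ℝ} (hR1 : 1 ≤ R) (j : Fin (k + 1))
    (hq1 : energyForm (radialCutoff R * f j) ≤
      physLevel ((j : ℕ) + 1) * (∫ y, (radialCutoff R * f j) y ^ 2) + A * Real.exp (-R))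
    (hq2 : 1 - A * Real.exp (-R) ≤ ∫ y, (radialCutoff R * f j) y ^ 2)
    (hAR : A * Real.exp (-R) ≤ 1 / 2)
    {B μ : ℝ} (hB : 0 < B) (hμ : 0 < μ) (hBμ : B * μ ^ 3 = 1 / 4) (hμ8 : μ ≤ 1 / 8) (hRμ : R ≤ 1 / (8 * μ)) (hBπ : π ≤ B) :
    8 * Real.exp (6 * B) * Real.sqrt (π / (B * μ ^ 2)) ^ 9 * (μ ^ 9 * ((2 * π ^ 2)⁻¹) ^ 3) ^ 2 *
        (∫ y, (radialCutoff R * f j) y ^ 2) *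
        (1 - 2 * μ * (physLevel ((j : ℕ) + 1) + 2 * A * Real.exp (-R))
          - μ ^ 2 * absLowerK (physLevel ((j : ℕ) + 1)) A (Cf ^ 2 * ∫ y : ZM, Real.exp (-‖y‖)) 0) ≤
      qform su2Rep B (fun U : Cfg => radialCutoff R (gnCoord μ U) * f j (gnCoord μ U))
        (fun U => radialCutoff R (gnCoord μ U) * f j (gnCoord μ U)) := by
  -- parameters and data
  have hR0 : 0 < R := lt_of_lt_of_le one_pos hR1
  have hE0 : 0 ≤ physLevel ((j : ℕ) + 1) := physLevel_nonneg (Nat.succ_le_succ (Nat.zero_le _))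
  have hJ0 : 0 ≤ ∫ y : ZM, Real.exp (-‖y‖) := integral_nonneg fun y => (Real.exp_pos _).le
  have hMom0 : 0 ≤ Cf ^ 2 * ∫ y : ZM, Real.exp (-‖y‖) := by positivity
  obtain ⟨hGtest, hGinv⟩ := isTestFn_isGaugeInv_cut hR0 hsmooth hinv j
  have hsupp : ∀ y, (radialCutoff R * f j) y ≠ 0 → ‖y‖ ≤ Real.sqrt 2 * R := fun y hy => norm_le_of_cut_ne_zero hR0 j hy
  have hμR : μ * R ≤ 1 / 8 := by
    have := mul_le_mul_of_nonneg_left hRμ hμ.le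
    rwa [show μ * (1 / (8 * μ)) = 1 / 8 by field_simp] at this
  have hwin : μ ^ 2 * (Real.sqrt 2 * R) ^ 2 ≤ 1 / 16 := by
    rw [sq_sqrt_two_mul]
    have h0 : 0 ≤ μ * R := by positivity
    have h1 : (μ * R) ^ 2 ≤ (1 / 8) ^ 2 := pow_le_pow_left₀ h0 hμR 2
    linarith only [h1]
  have hμhalf : μ ≤ 1 / 2 := by linarith
  have hμ1 : μ ≤ 1 := by linarith
  -- the structural bound (the goal is its right-hand side, definitionally)
  show _ ≤ qform su2Rep B (fun U : Cfg => (radialCutoff R * f j) (gnCoord μ U)) (fun U => (radialCutoff R * f j) (gnCoord μ U))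
  have hmain := qform_gnTrial_ge hB hμ hBμ hGtest hGinv hsupp hwin
  -- names for the real numbers involved
  generalize hGdef : radialCutoff R * f j = G at hGtest hGinv hsupp hmain hq1 hq2 ⊢
  generalize hEdef : physLevel ((j : ℕ) + 1) = E at hE0 hq1 ⊢
  have hM : ∀ m : ℕ, ∫ y, ‖y‖ ^ m * G y ^ 2 ≤ (m.factorial : ℝ) * (Cf ^ 2 * ∫ y : ZM, Real.exp (-‖y‖)) := fun m => by
    rw [← hGdef]; exact integral_pow_mul_cut_sq_le hCf R j m
  generalize hJdef : ∫ y : ZM, Real.exp (-‖y‖) = J at hJ0 hMom0 hM ⊢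
  have hN0 : 0 ≤ ∫ y, G y ^ 2 := integral_nonneg fun y => sq_nonneg _
  generalize hNdef : ∫ y, G y ^ 2 = N at hN0 hq1 hq2 hmain ⊢
  rw [show (2 : ℝ) * A * Real.exp (-R) = 2 * (A * Real.exp (-R)) by ring]
  generalize hTdef : A * Real.exp (-R) = T at hq1 hq2 hAR ⊢
  have hT0 : 0 ≤ T := by rw [← hTdef]; positivity
  -- `1 ≤ 2N`
  have hn2N : 1 ≤ 2 * N := by linarith only [hq2, hAR]
  -- moments of `G`
  generalize hMomdef : Cf ^ 2 * J = Mom at hMom0 hM ⊢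
  have hM2 := hM 2
  have hM6 := hM 6
  have hM10 := hM 10
  have f2 : ((2 : ℕ).factorial : ℝ) = 2 := by norm_num [Nat.factorial]
  have f6 : ((6 : ℕ).factorial : ℝ) = 720 := by norm_num [Nat.factorial]
  have f10 : ((10 : ℕ).factorial : ℝ) = 3628800 := by norm_num [Nat.factorial]
  rw [f2] at hM2; rw [f6] at hM6; rw [f10] at hM10
  have hMomN : Mom ≤ Mom * (2 * N) := by
    have := mul_le_mul_of_nonneg_left hn2N hMom0; linarith only [this]
  have hM2' : ∫ y, ‖y‖ ^ 2 * G y ^ 2 ≤ 4 * Mom * N := by linarith only [hM2, hMomN]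
  have hm0 : 0 ≤ ∫ y, ‖y‖ ^ 2 * G y ^ 2 := integral_nonneg fun y => by positivity
  -- energy split and the gradient bound
  have hGc : Continuous G := hGtest.continuous
  have hG2s : HasCompactSupport fun y => G y ^ 2 := GaussForm.hasCompactSupport_sq hGtest.2
  have hD : Integrable fun y => ‖gradient G y‖ ^ 2 := by
    have hG1 : ContDiff ℝ 1 G := hGtest.1.of_le (by norm_num)
    simp_rw [GaussForm.norm_gradient_eq]
    exact (((hG1.continuous_fderiv one_ne_zero).norm).pow 2).integrable_of_hasCompactSupport
      (GaussForm.hasCompactSupport_sq (hGtest.2.fderiv (𝕜 := ℝ)).norm)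
  have hV : Integrable fun y => luscherPotential y * G y ^ 2 := hGtest.integrable_mul_sq continuous_luscherPotential
  have hEsplit : energyForm G = (1 / 2 : ℝ) * (∫ y, ‖gradient G y‖ ^ 2) + ∫ y, luscherPotential y * G y ^ 2 := by
    rw [energyForm, integral_add (hD.const_mul _) hV, integral_const_mul]
  have hVG0 : 0 ≤ ∫ y, luscherPotential y * G y ^ 2 := integral_nonneg fun y => mul_nonneg (luscherPotential_nonneg y) (sq_nonneg _)
  have hDle : ∫ y, ‖gradient G y‖ ^ 2 ≤ 2 * (E * N) + 2 * N := by linarith only [hEsplit, hq1, hAR, hn2N, hVG0]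
  -- the `gnLip` moment
  have hm : ∀ m : ℕ, Integrable fun y => ‖y‖ ^ m * G y ^ 2 := fun m =>
    ((continuous_norm.pow m).mul (hGc.pow 2)).integrable_of_hasCompactSupport hG2s.mul_left
  have hL : ∫ y, G y ^ 2 * gnLip B μ y ^ 2 ≤ μ ^ 2 * (98677656 * Mom) := by
    have i1 : Integrable fun y => 108 * (‖y‖ ^ 2 * G y ^ 2) := (hm 2).const_mul _
    have i2 : Integrable fun y => 972 * (‖y‖ ^ 6 * G y ^ 2) := (hm 6).const_mul _
    have i3 : Integrable fun y => 27 * (‖y‖ ^ 10 * G y ^ 2) := (hm 10).const_mul _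
    have i12 : Integrable fun y => 108 * (‖y‖ ^ 2 * G y ^ 2) + 972 * (‖y‖ ^ 6 * G y ^ 2) := i1.add i2
    have i123 : Integrable fun y => 108 * (‖y‖ ^ 2 * G y ^ 2) + 972 * (‖y‖ ^ 6 * G y ^ 2) + 27 * (‖y‖ ^ 10 * G y ^ 2) := i12.add i3
    have hpt : ∀ y, G y ^ 2 * gnLip B μ y ^ 2 ≤ μ ^ 2 * (108 * (‖y‖ ^ 2 * G y ^ 2) + 972 * (‖y‖ ^ 6 * G y ^ 2) + 27 * (‖y‖ ^ 10 * G y ^ 2)) := by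
      intro y
      have := mul_le_mul_of_nonneg_left (gnLip_sq_le hμ hμhalf hBμ y) (sq_nonneg (G y))
      linarith only [this]
    calc ∫ y, G y ^ 2 * gnLip B μ y ^ 2 ≤ ∫ y, μ ^ 2 * (108 * (‖y‖ ^ 2 * G y ^ 2) + 972 * (‖y‖ ^ 6 * G y ^ 2) + 27 * (‖y‖ ^ 10 * G y ^ 2)) :=
          integral_mono_of_nonneg (ae_of_all _ fun y => by positivity) (i123.const_mul _) (ae_of_all _ hpt)
      _ = μ ^ 2 * (108 * (∫ y, ‖y‖ ^ 2 * G y ^ 2) + 972 * (∫ y, ‖y‖ ^ 6 * G y ^ 2) + 27 * ∫ y, ‖y‖ ^ 10 * G y ^ 2) := by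
          rw [integral_const_mul, integral_add i12 i3, integral_add i1 i2, integral_const_mul, integral_const_mul, integral_const_mul]
      _ ≤ μ ^ 2 * (98677656 * Mom) := by
          refine mul_le_mul_of_nonneg_left ?_ (sq_nonneg μ)
          linarith only [hM2, hM6, hM10]
  -- `Bμ² = 1/(4μ)` hence `4/(e·Bμ²) ≤ 16μ`
  have hBμ2 : B * μ ^ 2 = 1 / (4 * μ) := by
    rw [eq_div_iff (by positivity)]; linear_combination 4 * hBμ
  have he1 : 1 ≤ Real.exp 1 := Real.one_le_exp (by norm_num)
  have hfrac : 4 / (Real.exp 1 * (B * μ ^ 2)) ≤ 16 * μ := by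
    rw [hBμ2, div_le_iff₀ (by positivity)]
    have e4 : 16 * μ * (Real.exp 1 * (1 / (4 * μ))) = 4 * Real.exp 1 := by field_simp; ring
    rw [e4]; linarith only [he1]
  have hκ := kappa_le
  have hκ0 : 0 ≤ 8 / (3 * Real.exp 1) := by positivity
  have hs2 := sqrt_two_pow_nine_le
  -- the five pieces of ERR, each `≤ μ² · const · N`
  have t1 : 12 * μ ^ 2 * (∫ y, ‖y‖ ^ 2 * G y ^ 2) ≤ μ ^ 2 * (48 * Mom * N) := by
    have := mul_le_mul_of_nonneg_left hM2' (sq_nonneg μ); linarith only [this]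
  have t2 : 2 * μ ^ 2 * (∫ y, ‖gradient G y‖ ^ 2) ≤ μ ^ 2 * ((4 * E + 4) * N) := by
    have := mul_le_mul_of_nonneg_left hDle (sq_nonneg μ); linarith only [this]
  have t3 : 9 * (μ + 1 / 2) * (∫ y, G y ^ 2 * gnLip B μ y ^ 2) ≤ μ ^ 2 * (18 * 98677656 * Mom * N) := by
    have hl0 : 0 ≤ ∫ y, G y ^ 2 * gnLip B μ y ^ 2 := integral_nonneg fun y => by positivity
    have h91 : 9 * (μ + 1 / 2) ≤ 9 := by linarith
    have a1 : 9 * (μ + 1 / 2) * (∫ y, G y ^ 2 * gnLip B μ y ^ 2) ≤ 9 * ∫ y, G y ^ 2 * gnLip B μ y ^ 2 :=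
      mul_le_mul_of_nonneg_right h91 hl0
    have a2 : μ ^ 2 * (98677656 * Mom) ≤ μ ^ 2 * (98677656 * Mom * (2 * N)) := by
      refine mul_le_mul_of_nonneg_left ?_ (sq_nonneg μ)
      linarith only [hMomN]
    linarith only [a1, a2, hL]
  have t4 : μ ^ 2 * (8 / (3 * Real.exp 1)) * (3 * Real.sqrt 2 ^ 9 * (∫ y, ‖y‖ ^ 2 * G y ^ 2)) ≤ μ ^ 2 * (736 * Mom * N) := by
    have h1 : Real.sqrt 2 ^ 9 * (∫ y, ‖y‖ ^ 2 * G y ^ 2) ≤ 23 * (4 * Mom * N) := mul_le_mul hs2 hM2' hm0 (by norm_num)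
    have h2 : (8 / (3 * Real.exp 1)) * (3 * Real.sqrt 2 ^ 9 * (∫ y, ‖y‖ ^ 2 * G y ^ 2)) ≤ (8 / 3) * (3 * (23 * (4 * Mom * N))) :=
      mul_le_mul hκ (by linarith only [h1]) (mul_nonneg (by positivity) hm0) (by norm_num)
    have h3 := mul_le_mul_of_nonneg_left h2 (sq_nonneg μ)
    linarith only [h3]
  have t5 : μ ^ 2 * (8 / (3 * Real.exp 1)) * (2 * (4 / (Real.exp 1 * (B * μ ^ 2)) * (2 : ℝ) ^ 9) * N) ≤ μ ^ 2 * (21846 * N) := by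
    have h1 : 4 / (Real.exp 1 * (B * μ ^ 2)) * (2 : ℝ) ^ 9 ≤ 16 * μ * (2 : ℝ) ^ 9 := mul_le_mul_of_nonneg_right hfrac (by norm_num)
    have h2 : 2 * (4 / (Real.exp 1 * (B * μ ^ 2)) * (2 : ℝ) ^ 9) * N ≤ 2 * (16 * μ * (2 : ℝ) ^ 9) * N := by
      have := mul_le_mul_of_nonneg_right h1 hN0; linarith only [this]
    have h3 : 2 * (16 * μ * (2 : ℝ) ^ 9) * N ≤ 8192 * N := by
      have := mul_le_mul_of_nonneg_right hμhalf hN0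
      have e : 2 * (16 * μ * (2 : ℝ) ^ 9) * N = 16384 * (μ * N) := by ring
      rw [e]; linarith only [this]
    have h4 : (8 / (3 * Real.exp 1)) * (2 * (4 / (Real.exp 1 * (B * μ ^ 2)) * (2 : ℝ) ^ 9) * N) ≤ (8 / 3) * (8192 * N) :=
      mul_le_mul hκ (h2.trans h3) (mul_nonneg (by positivity) hN0) (by norm_num)
    have h5 := mul_le_mul_of_nonneg_left h4 (sq_nonneg μ)
    have hμN : 0 ≤ μ ^ 2 * N := mul_nonneg (sq_nonneg μ) hN0
    linarith only [h5, hμN]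
  -- the energy term (the tail `A e^{−R}` stays explicit, converted to a multiple of `N` via `1 ≤ 2N`)
  have hEn : 2 * μ * energyForm G ≤ 2 * μ * (E * N) + 2 * μ * (2 * T) * N := by
    have h2 : 2 * μ * energyForm G ≤ 2 * μ * (E * N + T) := mul_le_mul_of_nonneg_left hq1 (by positivity)
    have h3 : T ≤ T * (2 * N) := by
      have := mul_le_mul_of_nonneg_left hn2N hT0; linarith only [this]
    have h4 := mul_le_mul_of_nonneg_left h3 (by positivity : 0 ≤ 2 * μ)
    linarith only [h2, h4]
  -- the cross term
  have hP0 : 0 < 8 * Real.exp (6 * B) * Real.sqrt (π / (B * μ ^ 2)) ^ 9 * (μ ^ 9 * ((2 * π ^ 2)⁻¹) ^ 3) ^ 2 := by positivity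
  have hZc : Real.sqrt (π / (B * μ ^ 2)) ^ 9 * (μ ^ 9 * ((2 * π ^ 2)⁻¹) ^ 3) = Real.sqrt (π / B) ^ 9 / (2 * π ^ 2) ^ 3 := by
    rw [← mul_assoc, sqrt_div_mul_sq_pow_mul B μ hB hμ]; ring
  have hct := cross_term_le hBπ
  have hKc0 : 0 ≤ (2 * π ^ 2) ^ 3 * 720 * (4 / 15) ^ 6 / π ^ 5 := by positivity
  have e1 : 7 * Real.exp (9 / 4 * B) * (μ ^ 9 * ((2 * π ^ 2)⁻¹) ^ 3) =
      (8 * Real.exp (6 * B) * Real.sqrt (π / (B * μ ^ 2)) ^ 9 * (μ ^ 9 * ((2 * π ^ 2)⁻¹) ^ 3) ^ 2) *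
        ((7 / 8) * (Real.exp (-(15 / 4 * B)) * (2 * π ^ 2) ^ 3 / Real.sqrt (π / B) ^ 9)) := by
    have e0 : 8 * Real.exp (6 * B) * Real.sqrt (π / (B * μ ^ 2)) ^ 9 * (μ ^ 9 * ((2 * π ^ 2)⁻¹) ^ 3) ^ 2 =
        8 * Real.exp (6 * B) * (Real.sqrt (π / (B * μ ^ 2)) ^ 9 * (μ ^ 9 * ((2 * π ^ 2)⁻¹) ^ 3)) * (μ ^ 9 * ((2 * π ^ 2)⁻¹) ^ 3) := by
      ring
    rw [e0, hZc]
    have hexp : Real.exp (9 / 4 * B) = Real.exp (6 * B) * Real.exp (-(15 / 4 * B)) := by rw [← Real.exp_add]; ring_nf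
    rw [hexp]
    have key : Real.sqrt (π / B) ^ 9 / (2 * π ^ 2) ^ 3 * ((2 * π ^ 2) ^ 3 / Real.sqrt (π / B) ^ 9) = 1 := by
      rw [div_mul_div_comm, mul_comm (Real.sqrt (π / B) ^ 9), div_self (by positivity)]
    rw [show 8 * Real.exp (6 * B) * (Real.sqrt (π / B) ^ 9 / (2 * π ^ 2) ^ 3) * (μ ^ 9 * ((2 * π ^ 2)⁻¹) ^ 3) *
        (7 / 8 * (Real.exp (-(15 / 4 * B)) * (2 * π ^ 2) ^ 3 / Real.sqrt (π / B) ^ 9)) =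
        7 * (Real.exp (6 * B) * Real.exp (-(15 / 4 * B))) * (μ ^ 9 * ((2 * π ^ 2)⁻¹) ^ 3) *
        (Real.sqrt (π / B) ^ 9 / (2 * π ^ 2) ^ 3 * ((2 * π ^ 2) ^ 3 / Real.sqrt (π / B) ^ 9)) by ring, key, mul_one]
  have e2 : (1 : ℝ) / B = 4 * μ ^ 3 := by
    have : B = 1 / (4 * μ ^ 3) := by rw [eq_div_iff (by positivity)]; linear_combination 4 * hBμ
    rw [this, one_div_one_div]
  -- abstract the large atoms
  generalize hKcdef : (2 * π ^ 2) ^ 3 * 720 * (4 / 15) ^ 6 / π ^ 5 = Kc at hct hKc0 ⊢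
  rw [div_eq_mul_one_div Kc B, e2] at hct
  generalize hXdef : Real.exp (-(15 / 4 * B)) * (2 * π ^ 2) ^ 3 / Real.sqrt (π / B) ^ 9 = X at hct e1
  generalize hPdef : 8 * Real.exp (6 * B) * Real.sqrt (π / (B * μ ^ 2)) ^ 9 * (μ ^ 9 * ((2 * π ^ 2)⁻¹) ^ 3) ^ 2 = P at hP0 hmain e1 ⊢
  generalize hcdef : μ ^ 9 * ((2 * π ^ 2)⁻¹) ^ 3 = c at e1 hmain
  have hμ32 : μ ^ 3 ≤ μ ^ 2 := pow_le_pow_of_le_one hμ.le hμ1 (by norm_num)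
  have h43 : 4 * μ ^ 3 ≤ 4 * μ ^ 2 := by linarith [hμ32]
  have hX : X ≤ Kc * (4 * μ ^ 2) := hct.trans (mul_le_mul_of_nonneg_left h43 hKc0)
  have hcross : 7 * Real.exp (9 / 4 * B) * c * N ≤ P * N * (μ ^ 2 * (4 * Kc * (7 / 8))) := by
    rw [e1]
    have hPN : 0 ≤ P * N := mul_nonneg hP0.le hN0
    have := mul_le_mul_of_nonneg_left hX hPN
    linarith only [this]
  -- put together
  have hERR : 12 * μ ^ 2 * (∫ y, ‖y‖ ^ 2 * G y ^ 2) + 2 * μ ^ 2 * (∫ y, ‖gradient G y‖ ^ 2)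
        + 9 * (μ + 1 / 2) * (∫ y, G y ^ 2 * gnLip B μ y ^ 2)
        + μ ^ 2 * (8 / (3 * Real.exp 1)) * (3 * Real.sqrt 2 ^ 9 * (∫ y, ‖y‖ ^ 2 * G y ^ 2)
          + 2 * (4 / (Real.exp 1 * (B * μ ^ 2)) * (2 : ℝ) ^ 9) * N) ≤
      μ ^ 2 * ((48 * Mom + (4 * E + 4) + 18 * 98677656 * Mom + 736 * Mom + 21846) * N) := by
    linarith only [t1, t2, t3, t4, t5]
  -- the idle `12288·A` slot of `absLowerK … 0` is nonnegative slack
  have hslack : 0 ≤ P * N * (μ ^ 2 * (12288 * A * ((0 : ℕ) + 1 : ℝ))) := by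
    have : (0 : ℝ) ≤ ((0 : ℕ) + 1 : ℝ) := by norm_num
    have hPN : 0 ≤ P * N := mul_nonneg hP0.le hN0
    positivity
  unfold absLowerK
  rw [hKcdef]
  have hfin := mul_le_mul_of_nonneg_left hERR hP0.le
  have hfin2 := mul_le_mul_of_nonneg_left hEn hP0.le
  push_cast at hslack ⊢
  linarith only [hmain, hfin, hfin2, hcross, hslack]

end TrialRadius

/-! ### §2. (F6b) Norms and physicality of the one-site trial states -/

section Norms

variable {k : ℕ} {f : Fin (k + 1) → ZM → ℝ}

/-- `χ_R f_j` is a `C²_c` test function (`R > 0`; no colour invariance needed). [cite: ReedSimonIV1978, Thm. XIII.2] -/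
theorem isTestFn_cut {R : ℝ} (hR : 0 < R) (hsmooth : ∀ j, ∀ n : ℕ∞, ContDiff ℝ n (f j)) (j : Fin (k + 1)) :
    IsTestFn (radialCutoff R * f j) :=
  ⟨(isTestFn_radialCutoff hR).1.mul (contDiff_two_of_forall (hsmooth j)), (isTestFn_radialCutoff hR).2.mul_right⟩

/-- A uniform bound `∃ C, |χ_R f_j| ≤ C` (continuity + compact support). [folklore] -/
theorem exists_abs_cut_le {R : ℝ} (hR : 0 < R) (hsmooth : ∀ j, ∀ n : ℕ∞, ContDiff ℝ n (f j)) (j : Fin (k + 1)) :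
    ∃ C : ℝ, ∀ x, |(radialCutoff R * f j) x| ≤ C := by
  obtain ⟨C, _, hC⟩ := GaussForm.exists_bound_of_hasCompactSupport (isTestFn_cut hR hsmooth j).continuous (isTestFn_cut hR hsmooth j).2
  exact ⟨C, hC⟩

/-- **(F6b, upper)** `‖Ψ_j‖² ≤ 8c ∫(χ_R f_j)²`, `c = μ⁹(2π²)⁻³`. [cite: Luscher1983, §2–§3] -/
theorem l2_trial_le {μ R : ℝ} (hμ : 0 < μ) (hR : 0 < R) (hsmooth : ∀ j, ∀ n : ℕ∞, ContDiff ℝ n (f j)) (j : Fin (k + 1)) :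
    l2 (fun U : Cfg => radialCutoff R (gnCoord μ U) * f j (gnCoord μ U)) (fun U => radialCutoff R (gnCoord μ U) * f j (gnCoord μ U)) ≤
      8 * (μ ^ 9 * ((2 * π ^ 2)⁻¹) ^ 3) * ∫ y, (radialCutoff R * f j) y ^ 2 := by
  have hG := isTestFn_cut hR hsmooth j
  exact l2_gnPullback_le hμ hG.continuous.measurable (exists_abs_cut_le hR hsmooth j) hG.integrable_sq

/-- **(F6b, lower)** `8c(1 − 12μ²R²) ∫(χ_R f_j)² ≤ ‖Ψ_j‖²` (support radius `√2·R`). [cite: Luscher1983, §2–§3] -/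
theorem le_l2_trial {μ R : ℝ} (hμ : 0 < μ) (hR : 0 < R) (hsmooth : ∀ j, ∀ n : ℕ∞, ContDiff ℝ n (f j)) (j : Fin (k + 1)) :
    8 * (μ ^ 9 * ((2 * π ^ 2)⁻¹) ^ 3 * (1 - 12 * μ ^ 2 * R ^ 2)) * ∫ y, (radialCutoff R * f j) y ^ 2 ≤
      l2 (fun U : Cfg => radialCutoff R (gnCoord μ U) * f j (gnCoord μ U)) (fun U => radialCutoff R (gnCoord μ U) * f j (gnCoord μ U)) := by
  have hG := isTestFn_cut hR hsmooth j
  have h := le_l2_gnPullback hμ hG.continuous.measurable (exists_abs_cut_le hR hsmooth j) hG.integrable_sq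
    (fun y hy => norm_le_of_cut_ne_zero hR j hy)
  have e : 1 - 6 * (μ ^ 2 * (Real.sqrt 2 * R) ^ 2) = 1 - 12 * μ ^ 2 * R ^ 2 := by rw [sq_sqrt_two_mul]; ring
  rw [e] at h
  exact h

/-- **`Ψ_j` is a physical zero-flux test function** of the one-site model. [cite: Luscher1983, §2–§3] -/
theorem isPhys_trial (μ : ℝ) {R : ℝ} (hR : 0 < R) (hsmooth : ∀ j, ∀ n : ℕ∞, ContDiff ℝ n (f j)) (hinv : ∀ j, IsGaugeInv (f j))
    (j : Fin (k + 1)) : IsPhys (fun U : Cfg => radialCutoff R (gnCoord μ U) * f j (gnCoord μ U)) :=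
  isPhys_gnPullback (isTestFn_cut hR hsmooth j).continuous.measurable (exists_abs_cut_le hR hsmooth j)
    (isTestFn_isGaugeInv_cut hR hsmooth hinv j).2 μ

/-- Nonnegativity `0 ≤ ∫(χ_R f_j)²`. [folklore] -/
theorem integral_cut_sq_nonneg (R : ℝ) (j : Fin (k + 1)) : 0 ≤ ∫ y, (radialCutoff R * f j) y ^ 2 :=
  integral_nonneg fun _ => sq_nonneg _

end Norms

/-! ### §3. (F6a′/F6d) The estimate in the `linkC B³` currency and the comparison with `λ₀(B)` -/

section LinkCurrency

variable {k : ℕ} {f : Fin (k + 1) → ZM → ℝ}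

/-- The normaliser against the free link integral: `linkC B³ ≤ e^{6B} · Z · c`, `Z = √(π/(Bμ²))⁹`, `c = μ⁹(2π²)⁻³` (any `μ > 0`).
[cite: Luscher1983, §2–§3] -/
theorem linkC_pow_three_le_normaliser {B μ : ℝ} (hB : 0 < B) (hμ : 0 < μ) :
    linkC B ^ 3 ≤ Real.exp (6 * B) * (Real.sqrt (π / (B * μ ^ 2)) ^ 9 * (μ ^ 9 * ((2 * π ^ 2)⁻¹) ^ 3)) := by
  have h := linkC_pow_three_le_gauss hB
  have e : Real.sqrt (π / (B * μ ^ 2)) ^ 9 * (μ ^ 9 * ((2 * π ^ 2)⁻¹) ^ 3) = Real.sqrt (π / B) ^ 9 / (2 * π ^ 2) ^ 3 := by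
    rw [← mul_assoc, sqrt_div_mul_sq_pow_mul B μ hB hμ]; ring
  rw [e, ← mul_div_assoc]; exact h

/-- **(F6a′) The per-level trial estimate in the currency of the F9 assembly**: under the hypotheses of `trial_estimate_radius` and with
the bracket `θ_j/linkC B³ = 1 − 2μ(E_j + 2A e^{−R}) − μ²K ≥ 0`,
`linkC B³ · (1 − 2μ(E_j + 2A e^{−R}) − μ²K) · ‖Ψ_j‖² ≤ ⟨Ψ_j, K_B Ψ_j⟩`. [cite: Luscher1983, §2–§3] [cite: ReedSimonIV1978, Thm. XIII.1] -/
theorem linkC_trial_estimate_radius (hsmooth : ∀ j, ∀ n : ℕ∞, ContDiff ℝ n (f j)) (hinv : ∀ j, IsGaugeInv (f j))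
    {Cf : ℝ} (hCf : ∀ j x, |f j x| ≤ Cf * Real.exp (-‖x‖))
    {A : ℝ} (hA0 : 0 ≤ A) {R : ℝ} (hR1 : 1 ≤ R) (j : Fin (k + 1))
    (hq1 : energyForm (radialCutoff R * f j) ≤
      physLevel ((j : ℕ) + 1) * (∫ y, (radialCutoff R * f j) y ^ 2) + A * Real.exp (-R))
    (hq2 : 1 - A * Real.exp (-R) ≤ ∫ y, (radialCutoff R * f j) y ^ 2)
    (hAR : A * Real.exp (-R) ≤ 1 / 2)
    {B μ : ℝ} (hB : 0 < B) (hμ : 0 < μ) (hBμ : B * μ ^ 3 = 1 / 4) (hμ8 : μ ≤ 1 / 8) (hRμ : R ≤ 1 / (8 * μ)) (hBπ : π ≤ B)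
    (ht : 0 ≤ 1 - 2 * μ * (physLevel ((j : ℕ) + 1) + 2 * A * Real.exp (-R))
          - μ ^ 2 * absLowerK (physLevel ((j : ℕ) + 1)) A (Cf ^ 2 * ∫ y : ZM, Real.exp (-‖y‖)) 0) :
    linkC B ^ 3 * (1 - 2 * μ * (physLevel ((j : ℕ) + 1) + 2 * A * Real.exp (-R))
          - μ ^ 2 * absLowerK (physLevel ((j : ℕ) + 1)) A (Cf ^ 2 * ∫ y : ZM, Real.exp (-‖y‖)) 0) *
        l2 (fun U : Cfg => radialCutoff R (gnCoord μ U) * f j (gnCoord μ U)) (fun U => radialCutoff R (gnCoord μ U) * f j (gnCoord μ U)) ≤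
      qform su2Rep B (fun U : Cfg => radialCutoff R (gnCoord μ U) * f j (gnCoord μ U))
        (fun U => radialCutoff R (gnCoord μ U) * f j (gnCoord μ U)) := by
  have htrial := trial_estimate_radius hsmooth hinv hCf hA0 hR1 j hq1 hq2 hAR hB hμ hBμ hμ8 hRμ hBπ
  have hR0 : 0 < R := lt_of_lt_of_le one_pos hR1
  have h2 := l2_trial_le hμ hR0 hsmooth j
  have hlink := linkC_pow_three_le_normaliser hB hμ
  have hlink0 : 0 ≤ linkC B ^ 3 := pow_nonneg (linkC_pos hB.le).le 3
  have hN0 := integral_cut_sq_nonneg (f := f) R j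
  generalize hθ : 1 - 2 * μ * (physLevel ((j : ℕ) + 1) + 2 * A * Real.exp (-R))
      - μ ^ 2 * absLowerK (physLevel ((j : ℕ) + 1)) A (Cf ^ 2 * ∫ y : ZM, Real.exp (-‖y‖)) 0 = θ at ht htrial ⊢
  generalize hN : ∫ y, (radialCutoff R * f j) y ^ 2 = N at hN0 h2 htrial ⊢
  refine le_trans ?_ htrial
  calc linkC B ^ 3 * θ * l2 (fun U : Cfg => radialCutoff R (gnCoord μ U) * f j (gnCoord μ U)) (fun U => radialCutoff R (gnCoord μ U) * f j (gnCoord μ U))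
      ≤ linkC B ^ 3 * θ * (8 * (μ ^ 9 * ((2 * π ^ 2)⁻¹) ^ 3) * N) := mul_le_mul_of_nonneg_left h2 (mul_nonneg hlink0 ht)
    _ ≤ Real.exp (6 * B) * (Real.sqrt (π / (B * μ ^ 2)) ^ 9 * (μ ^ 9 * ((2 * π ^ 2)⁻¹) ^ 3)) * θ * (8 * (μ ^ 9 * ((2 * π ^ 2)⁻¹) ^ 3) * N) :=
        mul_le_mul_of_nonneg_right (mul_le_mul_of_nonneg_right hlink ht) (by positivity)
    _ = 8 * Real.exp (6 * B) * Real.sqrt (π / (B * μ ^ 2)) ^ 9 * (μ ^ 9 * ((2 * π ^ 2)⁻¹) ^ 3) ^ 2 * N * θ := by ring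

/-- **(F6d) The free normaliser in vacuum units**: there is `B₀ > 0` with `linkC B³ ≤ 2·λ₀(B)` and `λ₀(B) ≤ linkC B³` for all `B ≥ B₀`
(`λ₀(B) = levelValue su2Rep 1 B 0`; the tree's `PolyakovLift.exists_linkCE_le_two_mul_levelValue_zero` and `OST.levelValue_zero_le_linkCE` with `linkCE = linkC³` at `L = 1`).
[cite: ReedSimonIV1978, Thm. XIII.1] -/
theorem exists_linkC_pow_three_compare_levelValue_zero :
    ∃ B₀ : ℝ, 0 < B₀ ∧ ∀ B : ℝ, B₀ ≤ B →
      linkC B ^ 3 ≤ 2 * levelValue su2Rep 1 B 0 ∧ levelValue su2Rep 1 B 0 ≤ linkC B ^ 3 := by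
  obtain ⟨B₀, hB₀, h⟩ := PolyakovLift.exists_linkCE_le_two_mul_levelValue_zero
  refine ⟨B₀, hB₀, fun B hB => ?_⟩
  have e : linkCE B = linkC B ^ 3 := by rw [linkCE, card_edge_one]
  refine ⟨?_, ?_⟩
  · have h1 := h B hB; rwa [e] at h1
  · have h2 := OST.levelValue_zero_le_linkCE (hB₀.le.trans hB); rwa [e] at h2

end LinkCurrency

end Summit.QuantumFields.YangMills.Theorems.FemtoTransferGap.TransplantForms

end
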